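import Summits.CriticalPhenomena.PercolationContinuityZ3.Theorems.Transplant.FKConnectivityAllQApexTools
import Literature.Probability.LatticeModels.FKInterfacePairing
import Literature.Probability.Percolation.KozmaNitzanSeparatingTriple
import HarnessLib

/-!
# Connectivity correlation inequalities for `φ_{w,q}`, every `q > 0` — APEX-OVER-CYCLE CONFIGURATIONS, file 1: the rim automaton, the
# vertex-by-vertex configuration, one-step equations and insertion tools (file 2 `…WheelClusters.lean` proves the cluster-count theorems)

Support file (`--supports stmt-CriticalPhenomena-4575`), FK sub-lane `prim-bschramm-fk-3` (gen 8) of the post-continuity programme; builds on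
p205010 (kernel theorem, internal audit signed; external expert review pending).  Pure finite graph theory (no measures); no named facts, no sorries;
standard axioms.  Blueprint: bschramm/prim-bschramm-fk-3/WHEELS-HUB-NC.md §2 (LEMMA T) and §6.

SETTING.  A finite vertex type `V` with `Fintype.card V = n + 1`, a hub `x` and the rim vertices `v 0, …, v (n−1)` (pairwise distinct, `≠ x`); spoke
pairs `s(x, v j)` and rim pairs `s(v j, v ((j+1) % n))`; Boolean states `σ j` (spoke `j` open) and `τ j` (rim pair `j` open).  The open configuration is
built vertex by vertex, `FK.Wheel.conf σ τ x v n i` = the open pairs among the spokes and rim pairs of the vertices `j < i`, and the RIM AUTOMATON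
`FK.Wheel.run σ τ i = (c, s)` reads the same letters: `s` = 'the current rim arc already carries an open spoke', `c` = the number of closed rim pairs
that closed an arc WITHOUT open spoke.  These are exactly the states / `q`-exponents of the 2×2 transfer matrices `spokeM`, `edgeM` of
`…AllQWheelTransfer.lean` at parameters in `{0,1}`.
RESULTS (the invariant `FK.Wheel.conf_inv` and its consequences):
* **`FK.Wheel.clusterCount_conf_of_cut`** — if the closing rim pair `s(v (n−1), v 0)` is closed (`τ (n−1) = false`), then
  `k(conf n) = (run n).1 + 1` (one cluster for the hub with its attached arcs, one per spoke-less arc);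
* **`FK.Wheel.clusterCount_conf_of_no_cut`** — if every rim pair is open, `k(conf n) = 1` if some spoke is open and `= 2` otherwise;
* `FK.Wheel.mem_conf_iff` — `conf i` is the set of open pairs of the vertices `< i`.
With `FK.rcPartitionFunctionW_rigid_eq_pow` / `FK.eq_of_affine_of_rigid` (`…AllQRigidInterpolation.lean`) and the deterministic evaluation of the rigid
transfer words this yields LEMMA T (`Z_G = q·[Tr ∏ E(r_i)S(p_i) − (2−q)∏ r_i ∏(1−p_v)]`), hence — by `…AllQWheelTransfer.lean` — negative correlation of
any two spokes and of any two rim pairs of every apex-over-cycle weighted graph for every `0 < q ≤ 1` (THEOREMS W, W′ of the memo).  A cut can always be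
rotated to the closing position by re-indexing the rim, which is why only `τ (n−1) = false` and the no-cut case are treated.
[cite: Grimmett2006, §1.2 eq. (1.1), §1.4 eq. (1.20) (pp. 4, 15)]
-/

noncomputable section

namespace Summit.CriticalPhenomena.PercolationContinuityZ3.Theorems

namespace FK

namespace Wheel

open Literature.Probability.LatticeModels Literature.Probability.Percolation
open scoped Classical

variable {V : Type*} [Fintype V] [DecidableEq V]

/-- One step of the rim automaton at a vertex with spoke state `σv` and outgoing rim-pair state `τv`: an open spoke attaches the current arc; a closed
rim pair closes the arc, counting it if it carries no open spoke, and starts a fresh arc. (transcription of bschramm/prim-bschramm-fk-3/WHEELS-HUB-NC.md §2) -/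
def step (σv τv : Bool) (cs : ℕ × Bool) : ℕ × Bool :=
  if τv = true then (cs.1, cs.2 || σv) else (cs.1 + (if (cs.2 || σv) = true then 0 else 1), false)

/-- The rim automaton after the vertices `0, …, i−1`: `(number of closed spoke-less arcs, current arc attached?)`, started in `(0, false)`.
(transcription of bschramm/prim-bschramm-fk-3/WHEELS-HUB-NC.md §2) -/
def run (σ τ : ℕ → Bool) : ℕ → ℕ × Bool
  | 0 => (0, false)
  | i + 1 => step (σ i) (τ i) (run σ τ i)

/-- The open configuration of the vertices `< i`: the open spokes `s(x, v j)` and open rim pairs `s(v j, v ((j+1) % n))`, `j < i`, built by insertion.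
(transcription of bschramm/prim-bschramm-fk-3/WHEELS-HUB-NC.md §2) -/
def conf (σ τ : ℕ → Bool) (x : V) (v : ℕ → V) (n : ℕ) : ℕ → Finset (Sym2 V)
  | 0 => ∅
  | i + 1 =>
    if τ i = true then
      insert s(v i, v ((i + 1) % n)) (if σ i = true then insert s(x, v i) (conf σ τ x v n i) else conf σ τ x v n i)
    else (if σ i = true then insert s(x, v i) (conf σ τ x v n i) else conf σ τ x v n i)

/-- The configuration after the spoke of vertex `i`, before its rim pair. (transcription of bschramm/prim-bschramm-fk-3/WHEELS-HUB-NC.md §2) -/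
def confS (σ τ : ℕ → Bool) (x : V) (v : ℕ → V) (n i : ℕ) : Finset (Sym2 V) :=
  if σ i = true then insert s(x, v i) (conf σ τ x v n i) else conf σ τ x v n i

variable (σ τ : ℕ → Bool) (x : V) (v : ℕ → V) (n : ℕ)

/-! ### One-step equations -/

omit [Fintype V] [DecidableEq V] in
/-- Automaton, open rim pair: the count is unchanged. [folklore] -/
theorem run_succ_fst_of_open {i : ℕ} (ht : τ i = true) : (run σ τ (i + 1)).1 = (run σ τ i).1 := by
  simp [run, step, ht]

omit [Fintype V] [DecidableEq V] in
/-- Automaton, open rim pair: the arc continues, attached iff it was or the spoke is open. [folklore] -/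
theorem run_succ_snd_of_open {i : ℕ} (ht : τ i = true) : (run σ τ (i + 1)).2 = ((run σ τ i).2 || σ i) := by
  simp [run, step, ht]

omit [Fintype V] [DecidableEq V] in
/-- Automaton, closed rim pair: the arc is closed and counted if spoke-less. [folklore] -/
theorem run_succ_fst_of_closed {i : ℕ} (ht : τ i = false) :
    (run σ τ (i + 1)).1 = (run σ τ i).1 + (if ((run σ τ i).2 || σ i) = true then 0 else 1) := by
  simp [run, step, ht]

omit [Fintype V] [DecidableEq V] in
/-- Automaton, closed rim pair: a fresh unattached arc starts. [folklore] -/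
theorem run_succ_snd_of_closed {i : ℕ} (ht : τ i = false) : (run σ τ (i + 1)).2 = false := by
  simp [run, step, ht]

omit [Fintype V] in
/-- Configuration, open rim pair. [folklore] -/
theorem conf_succ_of_open {i : ℕ} (ht : τ i = true) :
    conf σ τ x v n (i + 1) = insert s(v i, v ((i + 1) % n)) (confS σ τ x v n i) := by
  show (if τ i = true then _ else _) = _
  rw [if_pos ht]
  rfl

omit [Fintype V] in
/-- Configuration, closed rim pair. [folklore] -/
theorem conf_succ_of_closed {i : ℕ} (ht : τ i = false) : conf σ τ x v n (i + 1) = confS σ τ x v n i := by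
  show (if τ i = true then _ else _) = _
  rw [if_neg (by rw [ht]; exact Bool.false_ne_true)]
  rfl

omit [Fintype V] in
/-- After an open spoke. [folklore] -/
theorem confS_of_open {i : ℕ} (hs : σ i = true) : confS σ τ x v n i = insert s(x, v i) (conf σ τ x v n i) := if_pos hs

omit [Fintype V] in
/-- After a closed spoke. [folklore] -/
theorem confS_of_closed {i : ℕ} (hs : σ i = false) : confS σ τ x v n i = conf σ τ x v n i :=
  if_neg (by rw [hs]; exact Bool.false_ne_true)

omit [Fintype V] in
/-- `confS i` is `conf i` or `conf i` with the spoke of `i` inserted. [folklore] -/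
theorem mem_confS_iff {i : ℕ} (e : Sym2 V) : e ∈ confS σ τ x v n i ↔ (σ i = true ∧ e = s(x, v i)) ∨ e ∈ conf σ τ x v n i := by
  cases hs : σ i
  · rw [confS_of_closed σ τ x v n hs]; simp
  · rw [confS_of_open σ τ x v n hs, Finset.mem_insert]; simp

omit [Fintype V] in
/-- **Membership**: `conf i` consists of the open spokes and open rim pairs of the vertices `< i`. (transcription of bschramm/prim-bschramm-fk-3/WHEELS-HUB-NC.md §2) -/
theorem mem_conf_iff (i : ℕ) (e : Sym2 V) :
    e ∈ conf σ τ x v n i ↔ (∃ j, j < i ∧ σ j = true ∧ e = s(x, v j)) ∨ (∃ j, j < i ∧ τ j = true ∧ e = s(v j, v ((j + 1) % n))) := by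
  induction i with
  | zero => simp [conf]
  | succ i ih =>
    have key : e ∈ conf σ τ x v n (i + 1) ↔ (τ i = true ∧ e = s(v i, v ((i + 1) % n))) ∨ e ∈ confS σ τ x v n i := by
      cases ht : τ i
      · rw [conf_succ_of_closed σ τ x v n ht]; simp
      · rw [conf_succ_of_open σ τ x v n ht, Finset.mem_insert]; simp
    rw [key, mem_confS_iff, ih]
    constructor
    · rintro (⟨ht, he⟩ | ⟨hs, he⟩ | ⟨j, hj, hs, he⟩ | ⟨j, hj, ht, he⟩)
      · exact Or.inr ⟨i, Nat.lt_succ_self i, ht, he⟩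
      · exact Or.inl ⟨i, Nat.lt_succ_self i, hs, he⟩
      · exact Or.inl ⟨j, Nat.lt_succ_of_lt hj, hs, he⟩
      · exact Or.inr ⟨j, Nat.lt_succ_of_lt hj, ht, he⟩
    · rintro (⟨j, hj, hs, he⟩ | ⟨j, hj, ht, he⟩)
      · rcases Nat.lt_succ_iff_lt_or_eq.1 hj with hj | rfl
        · exact Or.inr (Or.inr (Or.inl ⟨j, hj, hs, he⟩))
        · exact Or.inr (Or.inl ⟨hs, he⟩)
      · rcases Nat.lt_succ_iff_lt_or_eq.1 hj with hj | rfl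
        · exact Or.inr (Or.inr (Or.inr ⟨j, hj, ht, he⟩))
        · exact Or.inl ⟨ht, he⟩

omit [Fintype V] [DecidableEq V] in
/-- Along open rim pairs the automaton counts nothing and is attached iff some spoke so far is open. [folklore] -/
theorem run_of_all_open (i : ℕ) (hall : ∀ j, j < i → τ j = true) :
    (run σ τ i).1 = 0 ∧ ((run σ τ i).2 = true ↔ ∃ j, j < i ∧ σ j = true) := by
  induction i with
  | zero => simp [run]
  | succ i ih =>
    obtain ⟨h1, h2⟩ := ih fun j hj => hall j (Nat.lt_succ_of_lt hj)
    have hti : τ i = true := hall i (Nat.lt_succ_self i)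
    rw [run_succ_fst_of_open σ τ hti, run_succ_snd_of_open σ τ hti, Bool.or_eq_true, h2]
    refine ⟨h1, ?_⟩
    constructor
    · rintro (⟨j, hj, hs⟩ | hs)
      · exact ⟨j, Nat.lt_succ_of_lt hj, hs⟩
      · exact ⟨i, Nat.lt_succ_self i, hs⟩
    · rintro ⟨j, hj, hs⟩
      rcases Nat.lt_succ_iff_lt_or_eq.1 hj with hj | rfl
      · exact Or.inl ⟨j, hj, hs⟩
      · exact Or.inr hs

/-! ### Tools: the cluster count and reachability after inserting one pair -/

omit [DecidableEq V] in
/-- The empty configuration has one cluster per vertex. [cite: Grimmett2006, §1.2 eq. (1.1) (p. 4)] -/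
theorem clusterCount_emptyFinset : clusterCount (↑(∅ : Finset (Sym2 V)) : BondConfig V) (∅ : Set V) = Fintype.card V := by
  unfold clusterCount
  have hG : openGraph (↑(∅ : Finset (Sym2 V)) : BondConfig V) ⊔ wired (∅ : Set V) = ⊥ := by
    rw [wired_empty, sup_bot_eq, Finset.coe_empty]
    exact SimpleGraph.fromEdgeSet_empty
  rw [hG, ← Nat.card_eq_fintype_card]
  symm
  refine Nat.card_eq_of_bijective (fun u : V => (⊥ : SimpleGraph V).connectedComponentMk u) ⟨?_, ?_⟩
  · intro a b h
    exact SimpleGraph.reachable_bot.1 (SimpleGraph.ConnectedComponent.exact h)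
  · intro c
    induction c using SimpleGraph.ConnectedComponent.ind with
    | h u => exact ⟨u, rfl⟩

/-- `clusterCount_insert` with free boundary: inserting `s(a,b)` lowers the count by one iff `a`, `b` were not joined. [cite: Grimmett2006, §1.2 eq. (1.1) (p. 4)] -/
theorem clusterCount_insert_free (ω : Finset (Sym2 V)) (a b : V) :
    clusterCount (↑(insert s(a, b) ω) : BondConfig V) (∅ : Set V) +
        (if (openGraph (↑ω : BondConfig V)).Reachable a b then 0 else 1) =
      clusterCount (↑ω : BondConfig V) (∅ : Set V) := by
  have h := clusterCount_insert ω a b (∅ : Set V)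
  have hG : (openGraph (↑ω : BondConfig V) ⊔ wired (∅ : Set V)) = openGraph (↑ω : BondConfig V) := by
    rw [wired_empty, sup_bot_eq]
  by_cases hr : (openGraph (↑ω : BondConfig V)).Reachable a b
  · have hr' : (openGraph (↑ω : BondConfig V) ⊔ wired (∅ : Set V)).Reachable a b := by rw [hG]; exact hr
    rw [if_pos hr'] at h
    rw [if_pos hr]
    exact h
  · have hr' : ¬ (openGraph (↑ω : BondConfig V) ⊔ wired (∅ : Set V)).Reachable a b := by rw [hG]; exact hr
    rw [if_neg hr'] at h
    rw [if_neg hr]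
    exact h

/-- Inserting a pair whose endpoints are already joined does not change the count. [cite: Grimmett2006, §1.2 eq. (1.1) (p. 4)] -/
theorem clusterCount_insert_of_reachable (ω : Finset (Sym2 V)) {a b : V} (h : (openGraph (↑ω : BondConfig V)).Reachable a b) :
    clusterCount (↑(insert s(a, b) ω) : BondConfig V) (∅ : Set V) = clusterCount (↑ω : BondConfig V) (∅ : Set V) := by
  have h1 := clusterCount_insert_free ω a b
  rw [if_pos h, add_zero] at h1
  exact h1

/-- Inserting a pair whose endpoints are not joined lowers the count by one. [cite: Grimmett2006, §1.2 eq. (1.1) (p. 4)] -/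
theorem clusterCount_insert_of_not_reachable (ω : Finset (Sym2 V)) {a b : V} (h : ¬ (openGraph (↑ω : BondConfig V)).Reachable a b) :
    clusterCount (↑(insert s(a, b) ω) : BondConfig V) (∅ : Set V) + 1 = clusterCount (↑ω : BondConfig V) (∅ : Set V) := by
  have h1 := clusterCount_insert_free ω a b
  rw [if_neg h] at h1
  exact h1

omit [Fintype V] in
/-- Reachability after inserting the pair `s(a,b)` (coerced `Finset` form of `KNSep.reachable_insert_iff`). [folklore] -/
theorem reachable_coe_insert_iff (ω : Finset (Sym2 V)) (a b y z : V) :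
    (openGraph (↑(insert s(a, b) ω) : BondConfig V)).Reachable y z ↔
      (openGraph (↑ω : BondConfig V)).Reachable y z ∨
        ((openGraph (↑ω : BondConfig V)).Reachable y a ∧ (openGraph (↑ω : BondConfig V)).Reachable b z) ∨
        ((openGraph (↑ω : BondConfig V)).Reachable y b ∧ (openGraph (↑ω : BondConfig V)).Reachable a z) := by
  rw [Finset.coe_insert]
  exact KNSep.reachable_insert_iff (↑ω : BondConfig V) a b y z

omit [Fintype V] in
/-- Inserting pairs only adds open paths. [folklore] -/
theorem reachable_insert_of_reachable (ω : Finset (Sym2 V)) (e : Sym2 V) {y z : V} (h : (openGraph (↑ω : BondConfig V)).Reachable y z) :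
    (openGraph (↑(insert e ω) : BondConfig V)).Reachable y z := by
  rw [Finset.coe_insert]
  exact h.mono (openGraph_mono (Set.subset_insert _ _))

omit [Fintype V] [DecidableEq V] in
/-- A vertex met by no pair of the configuration is joined to nobody else. [folklore] -/
theorem not_reachable_of_fresh {ω : Finset (Sym2 V)} {u : V} (hu : ∀ e ∈ ω, u ∉ e) {y : V} (hy : y ≠ u) :
    ¬ (openGraph (↑ω : BondConfig V)).Reachable y u := by
  have h := FK.not_reachable_of_isolated (ω := (↑ω : BondConfig V)) (x := u) (z := y) (fun e he => hu e (Finset.mem_coe.1 he)) hy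
  exact fun hr => h hr.symm

omit [Fintype V] [DecidableEq V] in
/-- `(if b then 0 else 1) = 0` for `b = true`. [folklore] -/
theorem ind_of_true {b : Bool} (h : b = true) : (if b = true then (0 : ℕ) else 1) = 0 := by rw [if_pos h]

omit [Fintype V] [DecidableEq V] in
/-- `(if b then 0 else 1) = 1` for `b = false`. [folklore] -/
theorem ind_of_false {b : Bool} (h : b = false) : (if b = true then (0 : ℕ) else 1) = 1 := by
  rw [if_neg (by rw [h]; exact Bool.false_ne_true)]

end Wheel

end FK

end Summit.CriticalPhenomena.PercolationContinuityZ3.Theorems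

end
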